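import Summits.ValiantsHypothesis.ValiantsHypothesis.Theorems.LacunarySymmetroidMatrixDescartesCensusFatSectors

/-!
# `MatrixDescartes` — the SPAN-TWO SECTOR: pencils whose coefficients span a plane of matrices

HONEST FRAMING.  Object-search cell `pub-symmetroid`, crux `Theses.LacunarySymmetroid.MatrixDescartes`
(ledger item `stmt-ValiantsHypothesis-18050`, route `LacunarySymmetroid`; seat `val-sym-mdr-p1`).  The crux implies
`VP ≠ VNP` by the route's assembly and is at least summit-hard; NOTHING here is progress on it and nothing here is a
claim about `VP ≠ VNP`.  This file proves one elementary sector theorem and records the instance of the crux it gives.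

**Span-two sector** (`card_posRoots_spanTwo`).  Let `A, B` be ARBITRARY real `m × m` matrices (no symmetry, no
commutation, no rank hypothesis), `α β : Fin K → ℝ` and `d : Fin K → ℕ` (`K ≥ 1`).  The `K`-term lacunary pencil
`F = ∑ X^(d l) • (α l • A + β l • B)` — i.e. ANY lacunary pencil whose `K` coefficients lie in a two-dimensional space
of matrices — has at most `(m+1)(K−1)` distinct positive zeros of `det F`.  Proof: `F = a • A + b • B` with the
`K`-nomials `a = ∑ α l X^(d l)`, `b = ∑ β l X^(d l)` on the SAME support; at a positive zero `x` with `b(x) ≠ 0`,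
`det F(x) = b(x)^m · P(a(x)/b(x))` with `P(t) = det(tA + B)` of degree `≤ m`, so `x` is a positive zero of the
`K`-nomial `a − t·b` for one of the `≤ m` real roots `t` of `P` (`≤ K−1` each, sparse Descartes); the zeros of `b` add
`≤ K−1`.  (Degenerate cases `P ≡ 0`, `a ≡ t b`, `b ≡ 0` force `det F ≡ 0` or reduce to one `K`-nomial.)  The bound is
polynomial in the format although `A, B` are unrestricted: the first sector in the tree that is simultaneously
non-commuting, full-rank and size-unbounded.  It strictly contains the two-term sector (`a = X^(d₀)`, `b = X^(d₁)`,
tree `TwoTermSector`).  Span THREE already escapes the argument (`det F = P(a, b, c)` for a ternary form `P`; no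
factorisation), so this LOCATES the crux at coefficient spans of dimension `≥ 3`.

**The crux on the span-two sector, at all fat formats** (`matrixDescartes_spanTwoSector`): for all `c, q` there is
`K₀` such that for `K ≥ K₀`, `m ≤ 2^((⌊log₂K⌋+c)^c)`, all `d, α, β` and all real SYMMETRIC `A, B`, the pencil above
satisfies the crux's inequality `Z^q ≤ 2^(K⌊log₂K⌋)` (the reflected pencil is again span-two; `Z ≤ 2(m+1)(K−1)+1`;
tree `Census.fatFormat_absorb`).  Sector theorem only.

[folklore] Elementary: `Matrix.det_smul`, `RingHom.map_det`, `Polynomial.natDegree_det_X_add_C_le`,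
`Polynomial.eq_zero_of_infinite_isRoot`, and the tree's sparse Descartes rule
`Literature.Computability.AlgebraicComplexity.card_roots_toFinset_filter_pos_lt_card_support`.
-/

-- `Summit.ValiantsHypothesis.ValiantsHypothesis.…` repeats a component by the D-0017 layout
-- (single-conjunct summit), which the `dupNamespace` linter flags; the name is mandated.
set_option linter.dupNamespace false

namespace Summit.ValiantsHypothesis.ValiantsHypothesis.Theorems.LacunarySymmetroidMatrixDescartes.Census

open Polynomial Finset
open scoped BigOperators Polynomial Matrix

/-! ## §1 `K`-nomials on a fixed support -/

/-- The support of `∑ l, C (γ l) · X^(d l)` lies in the image of `d`. [folklore] -/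
theorem support_knomial_subset {K : ℕ} (γ : Fin K → ℝ) (d : Fin K → ℕ) :
    (∑ l, C (γ l) * X ^ d l).support ⊆ Finset.univ.image d := by
  intro n hn
  rw [mem_support_iff, finsetSum_coeff] at hn
  by_contra hnd
  apply hn
  refine Finset.sum_eq_zero fun l _ => ?_
  rw [coeff_C_mul_X_pow, if_neg]
  intro h
  exact hnd (Finset.mem_image.2 ⟨l, Finset.mem_univ _, h.symm⟩)

/-- A nonzero `K`-nomial has at most `K − 1` distinct positive roots (sparse Descartes rule). [folklore] -/
theorem card_posRoots_knomial_le {K : ℕ} (γ : Fin K → ℝ) (d : Fin K → ℕ)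
    (h : (∑ l, C (γ l) * X ^ d l) ≠ 0) :
    ((∑ l, C (γ l) * X ^ d l).roots.toFinset.filter (fun t => 0 < t)).card ≤ K - 1 := by
  have h1 := Literature.Computability.AlgebraicComplexity.card_roots_toFinset_filter_pos_lt_card_support h
  have h2 : (∑ l, C (γ l) * X ^ d l).support.card ≤ K :=
    (Finset.card_le_card (support_knomial_subset γ d)).trans
      (Finset.card_image_le.trans (by simp))
  omega

/-! ## §2 The span-two pencil and its evaluations -/

/-- A span-two pencil is `a • A + b • B` for the two `K`-nomials `a = ∑ α l X^(d l)`, `b = ∑ β l X^(d l)`. [folklore] -/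
theorem pencil_spanTwo_eq {K m : ℕ} (d : Fin K → ℕ) (A B : Matrix (Fin m) (Fin m) ℝ) (α β : Fin K → ℝ) :
    (∑ l, ((X : ℝ[X]) ^ d l) • (α l • A + β l • B).map C) =
      (∑ l, C (α l) * X ^ d l) • A.map C + (∑ l, C (β l) * X ^ d l) • B.map C := by
  refine Matrix.ext fun i j => ?_
  simp only [Matrix.sum_apply, Matrix.smul_apply, Matrix.add_apply, Matrix.map_apply, smul_eq_mul, map_add,
    map_mul, Finset.sum_mul, ← Finset.sum_add_distrib]
  exact Finset.sum_congr rfl fun l _ => by ring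

/-- Evaluating `det (a • A + b • B)` (polynomial coefficients `a, b`, constant matrices) at a real point. [folklore] -/
theorem eval_det_spanTwo {m : ℕ} (a b : ℝ[X]) (A B : Matrix (Fin m) (Fin m) ℝ) (x : ℝ) :
    (Matrix.det (a • A.map C + b • B.map C)).eval x = Matrix.det (a.eval x • A + b.eval x • B) := by
  rw [← Polynomial.coe_evalRingHom, RingHom.map_det]
  congr 1
  ext i j
  simp [Matrix.add_apply, Matrix.smul_apply, Matrix.map_apply]

/-- The linear pencil polynomial `P = det (X • A + B)` evaluates to `det (t A + B)`. [folklore] -/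
theorem eval_det_linPencil {m : ℕ} (A B : Matrix (Fin m) (Fin m) ℝ) (t : ℝ) :
    (Matrix.det ((X : ℝ[X]) • A.map C + B.map C)).eval t = Matrix.det (t • A + B) := by
  have e : (X : ℝ[X]) • A.map C + B.map C = (X : ℝ[X]) • A.map C + (1 : ℝ[X]) • B.map C := by rw [one_smul]
  rw [e, eval_det_spanTwo, eval_X, eval_one, one_smul]

/-- `det (a • A.map C) = a^m · C (det A)`. [folklore] -/
theorem det_smul_map_C {m : ℕ} (a : ℝ[X]) (A : Matrix (Fin m) (Fin m) ℝ) :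
    Matrix.det (a • A.map C) = a ^ m * C (Matrix.det A) := by
  rw [Matrix.det_smul, Fintype.card_fin, RingHom.map_det]
  rfl

/-! ## §3 The span-two sector -/

/-- **SPAN-TWO SECTOR.**  For arbitrary real `m × m` matrices `A, B`, coefficient vectors `α, β` and exponents `d` on
`K` terms, the lacunary pencil `∑ X^(d l) • (α l • A + β l • B)` has at most `(m+1)(K−1)` distinct positive zeros of
its determinant.  No symmetry, commutation or rank hypothesis. [folklore] -/
theorem card_posRoots_spanTwo {K m : ℕ} (d : Fin K → ℕ) (A B : Matrix (Fin m) (Fin m) ℝ)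
    (α β : Fin K → ℝ) :
    ((Matrix.det (∑ l, ((X : ℝ[X]) ^ d l) • (α l • A + β l • B).map C)).roots.toFinset.filter
        (fun t => 0 < t)).card ≤ (m + 1) * (K - 1) := by
  classical
  rw [pencil_spanTwo_eq]
  set a : ℝ[X] := ∑ l, C (α l) * X ^ d l with ha
  set b : ℝ[X] := ∑ l, C (β l) * X ^ d l with hb
  set Q : ℝ[X] := Matrix.det (a • A.map C + b • B.map C) with hQ
  set P : ℝ[X] := Matrix.det ((X : ℝ[X]) • A.map C + B.map C) with hP
  by_cases hQ0 : Q = 0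
  · rw [hQ0, roots_zero, Multiset.toFinset_zero, Finset.filter_empty, Finset.card_empty]
    exact Nat.zero_le _
  -- the `K`-nomials `a − t b`
  have hcomb : ∀ t : ℝ, a - C t * b = ∑ l, C (α l - t * β l) * X ^ d l := by
    intro t
    rw [ha, hb, Finset.mul_sum, ← Finset.sum_sub_distrib]
    refine Finset.sum_congr rfl fun l _ => ?_
    rw [map_sub, map_mul, sub_mul, mul_assoc]
  -- evaluation of `Q`
  have hQeval : ∀ x : ℝ, Q.eval x = Matrix.det (a.eval x • A + b.eval x • B) := fun x => eval_det_spanTwo a b A B x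
  -- if `a = C t * b` for a root `t` of `P` then `Q = 0`
  have hdeg : ∀ t : ℝ, P.eval t = 0 → a - C t * b = 0 → Q = 0 := by
    intro t ht hab
    have hab' : a = C t * b := sub_eq_zero.1 hab
    have h1 : a • A.map C + b • B.map C = b • ((C t) • A.map C + B.map C) := by
      rw [hab', smul_add, smul_smul, mul_comm]
    have h2 : Matrix.det ((C t) • A.map C + B.map C) = C (Matrix.det (t • A + B)) := by
      have e : (C t) • A.map C + B.map C = (t • A + B).map C := by
        ext i j
        simp [Matrix.add_apply, Matrix.smul_apply, Matrix.map_apply]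
      rw [e, RingHom.map_det]
      rfl
    rw [hQ, h1, Matrix.det_smul, h2, ← eval_det_linPencil, ← hP, ht, map_zero, mul_zero]
  -- positive zeros of the `K`-nomials `a − t b` number at most `K − 1`
  have hgt : ∀ t : ℝ, ((a - C t * b).roots.toFinset.filter (fun s => 0 < s)).card ≤ K - 1 := by
    intro t
    by_cases hg : a - C t * b = 0
    · rw [hg, roots_zero, Multiset.toFinset_zero, Finset.filter_empty, Finset.card_empty]
      exact Nat.zero_le _
    · rw [hcomb t] at hg ⊢
      exact card_posRoots_knomial_le _ d hg
  by_cases hb0 : b = 0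
  · -- `b = 0`: `Q = a^m · C(det A)`; the positive zeros of `Q` are among those of `a`
    have hQa : Q = a ^ m * C (Matrix.det A) := by
      rw [hQ, hb0, zero_smul, add_zero, det_smul_map_C]
    have hsub : Q.roots.toFinset.filter (fun s => 0 < s) ⊆ a.roots.toFinset.filter (fun s => 0 < s) := by
      intro x hx
      rw [Finset.mem_filter, Multiset.mem_toFinset, mem_roots hQ0, IsRoot.def] at hx
      obtain ⟨hx, hxpos⟩ := hx
      rw [hQa, eval_mul, eval_pow, eval_C] at hx
      have ha0 : a ≠ 0 := by
        intro h0
        apply hQ0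
        rw [hQa, h0]
        rcases Nat.eq_zero_or_pos m with hm | hm
        · subst hm
          exfalso
          rw [h0, eval_zero, pow_zero, one_mul, Matrix.det_isEmpty] at hx
          exact one_ne_zero hx
        · rw [zero_pow hm.ne', zero_mul]
      have hax : a.eval x = 0 := by
        rcases mul_eq_zero.1 hx with h | h
        · exact (pow_eq_zero_iff' .. |>.1 h).1
        · exfalso
          apply hQ0
          rw [hQa, h, map_zero, mul_zero]
      rw [Finset.mem_filter, Multiset.mem_toFinset, mem_roots ha0, IsRoot.def]
      exact ⟨hax, hxpos⟩
    have ha' : (a.roots.toFinset.filter (fun s => 0 < s)).card ≤ K - 1 := by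
      have h := hgt 0
      rwa [map_zero, zero_mul, sub_zero] at h
    calc (Q.roots.toFinset.filter (fun s => 0 < s)).card
        ≤ (a.roots.toFinset.filter (fun s => 0 < s)).card := Finset.card_le_card hsub
      _ ≤ K - 1 := ha'
      _ ≤ (m + 1) * (K - 1) := Nat.le_mul_of_pos_left _ (Nat.succ_pos m)
  · -- `b ≠ 0`: positive zeros of `Q` are zeros of `b` or of `a − t b` for a real root `t` of `P`
    have hPne : P ≠ 0 := by
      intro hP0
      apply hQ0
      apply Polynomial.eq_zero_of_infinite_isRoot
      have hinf : Set.Infinite {y : ℝ | b.eval y ≠ 0} := by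
        have hfin : Set.Finite (↑b.roots.toFinset : Set ℝ) := b.roots.toFinset.finite_toSet
        refine (hfin.infinite_compl).mono fun y hy => ?_
        intro hy0
        exact hy (by
          rw [Finset.mem_coe, Multiset.mem_toFinset, mem_roots hb0, IsRoot.def]
          exact hy0)
      refine hinf.mono fun y hy => ?_
      have hy : b.eval y ≠ 0 := hy
      show Q.IsRoot y
      rw [IsRoot.def, hQeval]
      have e : a.eval y • A + b.eval y • B = b.eval y • ((a.eval y / b.eval y) • A + B) := by
        rw [smul_add, smul_smul, mul_div_cancel₀ _ hy]
      rw [e, Matrix.det_smul, ← eval_det_linPencil, ← hP, hP0, eval_zero, mul_zero]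
    have hsub : Q.roots.toFinset.filter (fun s => 0 < s) ⊆
        b.roots.toFinset.filter (fun s => 0 < s) ∪
          P.roots.toFinset.biUnion (fun t => (a - C t * b).roots.toFinset.filter (fun s => 0 < s)) := by
      intro x hx
      rw [Finset.mem_filter, Multiset.mem_toFinset, mem_roots hQ0, IsRoot.def] at hx
      obtain ⟨hx, hxpos⟩ := hx
      rw [Finset.mem_union]
      by_cases hbx : b.eval x = 0
      · left
        rw [Finset.mem_filter, Multiset.mem_toFinset, mem_roots hb0, IsRoot.def]
        exact ⟨hbx, hxpos⟩
      · right
        set t : ℝ := a.eval x / b.eval x with ht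
        have hPt : P.eval t = 0 := by
          rw [hQeval] at hx
          have e : a.eval x • A + b.eval x • B = b.eval x • (t • A + B) := by
            rw [smul_add, smul_smul, ht, mul_div_cancel₀ _ hbx]
          rw [e, Matrix.det_smul, Fintype.card_fin] at hx
          rcases mul_eq_zero.1 hx with h | h
          · exact absurd ((pow_eq_zero_iff' .. |>.1 h).1) hbx
          · rw [eval_det_linPencil]
            exact h
        have hg0 : a - C t * b ≠ 0 := fun hg => hQ0 (hdeg t hPt hg)
        rw [Finset.mem_biUnion]
        refine ⟨t, ?_, ?_⟩
        · rw [Multiset.mem_toFinset, mem_roots hPne, IsRoot.def]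
          exact hPt
        · rw [Finset.mem_filter, Multiset.mem_toFinset, mem_roots hg0, IsRoot.def, eval_sub, eval_mul, eval_C,
            ht, div_mul_cancel₀ _ hbx, sub_self]
          exact ⟨rfl, hxpos⟩
    have hb' : (b.roots.toFinset.filter (fun s => 0 < s)).card ≤ K - 1 := by
      rw [hb] at hb0 ⊢
      exact card_posRoots_knomial_le _ d hb0
    have hProots : P.roots.toFinset.card ≤ m := by
      calc P.roots.toFinset.card ≤ Multiset.card P.roots := Multiset.toFinset_card_le _
        _ ≤ P.natDegree := Polynomial.card_roots' P
        _ ≤ m := by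
          have h := Polynomial.natDegree_det_X_add_C_le A B
          rwa [Fintype.card_fin] at h
    calc (Q.roots.toFinset.filter (fun s => 0 < s)).card
        ≤ (b.roots.toFinset.filter (fun s => 0 < s) ∪
            P.roots.toFinset.biUnion (fun t => (a - C t * b).roots.toFinset.filter (fun s => 0 < s))).card :=
          Finset.card_le_card hsub
      _ ≤ (b.roots.toFinset.filter (fun s => 0 < s)).card +
            (P.roots.toFinset.biUnion (fun t => (a - C t * b).roots.toFinset.filter (fun s => 0 < s))).card :=
          Finset.card_union_le _ _
      _ ≤ (K - 1) + P.roots.toFinset.card * (K - 1) := by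
          refine Nat.add_le_add hb' ?_
          calc _ ≤ ∑ t ∈ P.roots.toFinset, ((a - C t * b).roots.toFinset.filter (fun s => 0 < s)).card :=
                Finset.card_biUnion_le
            _ ≤ ∑ _t ∈ P.roots.toFinset, (K - 1) := Finset.sum_le_sum fun t _ => hgt t
            _ = P.roots.toFinset.card * (K - 1) := by rw [Finset.sum_const, smul_eq_mul]
      _ ≤ (K - 1) + m * (K - 1) := Nat.add_le_add_left (Nat.mul_le_mul_right _ hProots) _
      _ = (m + 1) * (K - 1) := by ring

/-! ## §4 The crux on the span-two sector, at all fat formats -/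

/-- Reflection `X ↦ −X` keeps a span-two pencil span-two. [folklore] -/
theorem reflect_spanTwo {K m : ℕ} (d : Fin K → ℕ) (A B : Matrix (Fin m) (Fin m) ℝ) (α β : Fin K → ℝ)
    (l : Fin K) :
    ((-1 : ℝ) ^ d l) • (α l • A + β l • B) = ((-1 : ℝ) ^ d l * α l) • A + ((-1 : ℝ) ^ d l * β l) • B := by
  rw [smul_add, smul_smul, smul_smul]

/-- All distinct real zeros on the span-two sector: `Z ≤ 2(m+1)(K−1) + 1` (the sector bound for the pencil and for
its reflection, plus the origin; tree `stub_negRoots`). [folklore] -/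
theorem card_roots_spanTwo {K m : ℕ} (d : Fin K → ℕ) (A B : Matrix (Fin m) (Fin m) ℝ) (α β : Fin K → ℝ) :
    (Matrix.det (∑ l, ((X : ℝ[X]) ^ d l) • (α l • A + β l • B).map C)).roots.toFinset.card
      ≤ 2 * ((m + 1) * (K - 1)) + 1 := by
  have h1 := card_posRoots_spanTwo d A B α β
  have h2 : ((Matrix.det (∑ l, ((X : ℝ[X]) ^ d l) •
      (((-1 : ℝ) ^ d l * α l) • A + ((-1 : ℝ) ^ d l * β l) • B).map C)).roots.toFinset.filter
        (fun t => 0 < t)).card ≤ (m + 1) * (K - 1) :=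
    card_posRoots_spanTwo d A B (fun l => (-1 : ℝ) ^ d l * α l) (fun l => (-1 : ℝ) ^ d l * β l)
  have h3 := stub_negRoots K m d (fun l => α l • A + β l • B)
  simp only [reflect_spanTwo] at h3
  omega

/-- **`MatrixDescartes` holds on the span-two sector, at all fat formats.**  For all `c, q` there is `K₀` such that
for `K ≥ K₀`, `m ≤ 2^((⌊log₂K⌋+c)^c)`, all exponents `d`, all real `m × m` matrices `A, B` (symmetric or not,
commuting or not, any rank) and all `α, β`, the pencil `∑ X^(d l) • (α l • A + β l • B)` satisfies the crux's
inequality `Z^q ≤ 2^(K⌊log₂K⌋)` (`Z ≤ 2(m+1)(K−1)+1 ≤ 2(m+1)(K+1)`, tree `Census.fatFormat_absorb`).  Sector theorem: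
the crux itself concerns coefficient spans of dimension up to `K`. [folklore] -/
theorem matrixDescartes_spanTwoSector (c q : ℕ) : ∃ K₀ : ℕ, ∀ K m : ℕ, K₀ ≤ K →
    m ≤ 2 ^ ((Nat.log 2 K + c) ^ c) →
    ∀ (d : Fin K → ℕ) (A B : Matrix (Fin m) (Fin m) ℝ) (α β : Fin K → ℝ),
      (Matrix.det (∑ l, ((X : ℝ[X]) ^ d l) • (α l • A + β l • B).map C)).roots.toFinset.card ^ q
        ≤ 2 ^ (K * Nat.log 2 K) := by
  obtain ⟨K₀, hK₀⟩ := fatFormat_absorb 1 c q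
  refine ⟨K₀, fun K m hK hm d A B α β => hK₀ K m _ hK hm ?_⟩
  have h := card_roots_spanTwo d A B α β
  have h1 : (m + 1) * (K - 1) ≤ (m + 1) * K := Nat.mul_le_mul_left _ (Nat.sub_le K 1)
  have e : 2 ^ 1 * (m + 1) * (K + 1) = 2 * ((m + 1) * K) + 2 * (m + 1) := by ring
  rw [e]
  omega

end Summit.ValiantsHypothesis.ValiantsHypothesis.Theorems.LacunarySymmetroidMatrixDescartes.Census
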